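import Mathlib
import Literature.Topology.FourManifolds.PlanarAchiralWords
import Literature.Topology.FourManifolds.PlanarShadowWalk
import Summits.SmoothPoincare4.SmoothPoincare4.Theorems.ConvexBisectionPlanarAcyclicBisectionRigidityHelperWalkThreeAssembly
import Summits.SmoothPoincare4.SmoothPoincare4.Theorems.ConvexBisectionPlanarAcyclicBisectionRigidityHelperShadowFaithfulThree
import Summits.SmoothPoincare4.SmoothPoincare4.Theorems.ConvexBisectionPlanarAcyclicBisectionRigidityHelperTwistLiftThree
import Summits.SmoothPoincare4.SmoothPoincare4.Theorems.ConvexBisectionPlanarAcyclicBisectionRigidityHelperTypesPermThree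
import HarnessLib

/-!
# Crux `ConvexBisection.PlanarAcyclicBisectionRigidity`, line Sketch v3.0 — `stub_walk3`

The registered stub `stub_walk3` of the skeleton `Lines/Sketch.lean`: every integral homotopy-sphere
word on three holes, in ANY spelling of its letters, walks (Hurwitz moves, global conjugations,
stabilisations) to an honest double at level `3`.  It is the assembly `helper_walk3_ofHelpers`
(parts 1, 2, 3a–3c of the level-3 walk) fed with the three analytic helpers: faithfulness of the
`F₂` shadow of the `{T_[0,1], T_[1,2]}`-words in the arc-data model (`helper_shadow_faithful3`), the
twist-level lift of the `F₂` lever (`helper_twistLift3`), and the agreement of the hole-type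
multisets of two blocks with equal monodromy (`helper_types_perm3`).
-/

noncomputable section

open Literature.Topology.FourManifolds Literature.Topology.FourManifolds.PlanarWords

-- the prescribed namespace `Summit.<S>.<P>.…` repeats `SmoothPoincare4` (S = P = SmoothPoincare4)
set_option linter.dupNamespace false

namespace Summit.SmoothPoincare4.SmoothPoincare4.Theorems.PlanarAcyclicBisectionRigidity.Sketch

open ReachMon in
/-- **Registered stub `stub_walk3`** (line Sketch v3.0): every integral homotopy-sphere word on three
holes walks to an honest double at level `3`. [folklore] -/
theorem stub_walk3 (A B : List PlanarCurve) (hw : IsIntegralSphereWord 3 A B) :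
    ∃ (A' B' : List PlanarCurve),
      Reachable (3, blockForm A B) (3, blockForm A' B') ∧ TwistEq 3 A' B' :=
  helper_walk3_ofHelpers helper_shadow_faithful3 helper_twistLift3 helper_types_perm3 A B hw

end Summit.SmoothPoincare4.SmoothPoincare4.Theorems.PlanarAcyclicBisectionRigidity.Sketch

end
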